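import Summits.CriticalPhenomena.PercolationContinuityZ3.Theorems.SahiMasterFamilyPrivateGluingPrelim

/-!
# The zero-flag class is closed under private gluing (Lemma P at every order)

Unit `prim-master-conj` (crux anchor stmt-CriticalPhenomena-4575), gen 7.  **Private gluing.**  Let `U` be a family of `k ≥ 2` increasing
events, `c` a slot, `e` a coordinate on which no OTHER member depends, and `A ⊆ B` increasing events not depending on `e` with
`U c = A ∪ (B ∩ [e open])` — equivalently `A`, `B` are the two `e`-sections of `U c` and `e` is PRIVATE to the slot `c`.  If both
families `U[c ↦ A]`, `U[c ↦ B]` lie in the recursive zero-flag class `Z_k` (`SuppZeroFlag`), then so does `U` (`suppZeroFlag_glue`, every `k`;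
section form `suppZeroFlag_of_secAt`).  Since `E_k(μ_p; U) = (1 − p_e)·E_k(U[c ↦ A]) + p_e·E_k(U[c ↦ B])`, this is forced by the master
conjecture; here it is proved combinatorially, from the structure theory of gen 6 (`SahiMasterFamilyStruct*`), by induction on `k`:
* some member empty, or `A = ∅` (the coordinate shrink `suppZeroFlag_update_inter_coord`): trivial;
* `V := U` off `c` structured: `A` and `B` are last-able over a good chain of `V` (SYM, `goodChain_cons_of_structured_erase`), and the
  annihilator of `A ∪ (B ∩ [e])` over that chain lies in the union of those of `A` and `B` (`annihilator_glue_subset`);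
* `V` not structured: the canonical frames of the members of `V` inside `V + A` and `V + B` AGREE (`cframe_eq_of_supersets`); some member
  `i` of `V` has a non-empty annihilator (else `V` is a disjoint frame, structured), so it is removable in both (C,
  `structured_erase_of_not_subset`); by SYM + D (`structured_update_inter_head`) the slot of `i` is good in the recursion for both families,
  and the induction hypothesis (plain, shrunk members, shrunk `c`-slot with `A ∩ U i ⊆ B ∩ U i`) makes it good for `U`.
Consequence for the identically-zero master conjecture (`masterFamilyIdentEqIff_iff_nonvanishing`): since minors of identically-zero
families are identically zero, in the minors induction a terminal family has NO PRIVATE COORDINATE, at every order (order 3 = the tree's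
Lemma P, `SahiMasterFamilyLemmaP`).  Pure combinatorics; axioms standard. [this work]
-/

noncomputable section

open scoped Classical

namespace Summit.CriticalPhenomena.PercolationContinuityZ3.Theorems

open Finset Function
open Literature.Probability.LatticeModels.Kahn2022 (Affects)
open Literature.Probability.Percolation (DeterminedBy)

variable {ι : Type} [Fintype ι]

section Glue

/-- **Private gluing, every order** (`MA_k`): if `e` acts on no member of `U` off the slot `c`, `A ⊆ B` are increasing events not depending
on `e` with `U c = A ∪ (B ∩ [e open])`, and both `U[c ↦ A]`, `U[c ↦ B]` lie in `Z_{k+2}`, then `U ∈ Z_{k+2}`. [this work] -/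
theorem suppZeroFlag_glue : ∀ (k : ℕ) (U : Fin (k + 2) → Set (Set ι)) (c : Fin (k + 2)) (A B : Set (Set ι)) (e : ι),
    (∀ j, IsUpperSet (U j)) → IsUpperSet A → IsUpperSet B → A ⊆ B →
    (∀ j, j ≠ c → ¬ Affects (U j) e) → ¬ Affects A e → ¬ Affects B e →
    U c = A ∪ (B ∩ {ω | e ∈ ω}) →
    SuppZeroFlag (k + 2) (update U c A) → SuppZeroFlag (k + 2) (update U c B) → SuppZeroFlag (k + 2) U
  | 0, U, c, A, B, e, hU, hA, hB, _, heU, _, _, hUc, hZA, hZB => suppZeroFlag_glue_two U c A B e hU hA hB heU hUc hZA hZB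
  | k + 1, U, c, A, B, e, hU, hA, hB, hAB, heU, heA, heB, hUc, hZA, hZB => by
    -- an empty member: trivial
    by_cases hempty : ∃ j, U j = ∅
    · obtain ⟨j, hj⟩ := hempty; exact suppZeroFlag_of_mem_empty (k + 2) U j hj
    have hUne : ∀ j, (U j).Nonempty := fun j => Set.nonempty_iff_ne_empty.2 fun h => hempty ⟨j, h⟩
    -- the coordinate event `[e open]`
    set Pe : Set (Set ι) := {ω | e ∈ ω} with hPe
    have hPeU : IsUpperSet Pe := isUpperSet_coord e
    have hPene : Pe.Nonempty := ⟨Set.univ, Set.mem_univ e⟩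
    have hUB : ∀ j, IsUpperSet (update U c B j) := by
      intro j; by_cases hj : j = c
      · subst hj; rw [update_self]; exact hB
      · rw [update_of_ne hj]; exact hU j
    /- the structure theory works with the classical decidability instance on the index type `Fin (k+3) ⊕ Bool` -/
    letI : DecidableEq (Fin (k + 1 + 2) ⊕ Bool) := fun a b => Classical.propDecidable (a = b)
    -- the two enumerations of the extended index type: slot `c` ↦ the `A`-copy resp. the `B`-copy
    set VA : Fin (k + 1 + 2) → Fin (k + 1 + 2) ⊕ Bool := fun j => if j = c then Sum.inr false else Sum.inl j with hVA
    set VB : Fin (k + 1 + 2) → Fin (k + 1 + 2) ⊕ Bool := fun j => if j = c then Sum.inr true else Sum.inl j with hVB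
    have hVAc : VA c = Sum.inr false := by simp [hVA]
    have hVBc : VB c = Sum.inr true := by simp [hVB]
    have hVAj : ∀ {j}, j ≠ c → VA j = Sum.inl j := fun hj => by simp [hVA, hj]
    have hVBj : ∀ {j}, j ≠ c → VB j = Sum.inl j := fun hj => by simp [hVB, hj]
    have hVAinj : Injective VA := by
      intro j j' h
      by_cases hj : j = c <;> by_cases hj' : j' = c
      · rw [hj, hj']
      · rw [hj, hVAc, hVAj hj'] at h; exact absurd h (by simp)
      · rw [hj', hVAc, hVAj hj] at h; exact absurd h (by simp)
      · rw [hVAj hj, hVAj hj'] at h; exact Sum.inl_injective h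
    have hVBinj : Injective VB := by
      intro j j' h
      by_cases hj : j = c <;> by_cases hj' : j' = c
      · rw [hj, hj']
      · rw [hj, hVBc, hVBj hj'] at h; exact absurd h (by simp)
      · rw [hj', hVBc, hVBj hj] at h; exact absurd h (by simp)
      · rw [hVBj hj, hVBj hj'] at h; exact Sum.inl_injective h
    -- `A = ∅`: `U c = B ∩ [e]` is `U[c ↦ B]` with the slot `c` shrunk by the independent event `[e]`
    by_cases hA0 : A = ∅
    · have hUc' : U c = B ∩ Pe := by rw [hUc, hA0, Set.empty_union]
      have heUB : ∀ j, ¬ Affects (update U c B j) e := by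
        intro j; by_cases hj : j = c
        · subst hj; rw [update_self]; exact heB
        · rw [update_of_ne hj]; exact heU j hj
      have h := suppZeroFlag_update_inter_coord (update U c B) hUB c e heUB hZB
      rwa [update_idem, update_self, ← hUc', update_eq_self] at h
    have hAne : A.Nonempty := Set.nonempty_iff_ne_empty.2 hA0
    have hBne : B.Nonempty := hAne.mono hAB
    /- the ambient family on `Fin (k+3) ⊕ Bool`: `inl j ↦ U j`, `inr false ↦ A`, `inr true ↦ B` -/
    set Ut : Fin (k + 1 + 2) ⊕ Bool → Set (Set ι) := Sum.elim U (fun b => cond b B A) with hUt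
    have hUtU : ∀ x, IsUpperSet (Ut x) := by
      rintro (j | b)
      · exact hU j
      · cases b
        · exact hA
        · exact hB
    have hUtne : ∀ x, (Ut x).Nonempty := by
      rintro (j | b)
      · exact hUne j
      · cases b
        · exact hAne
        · exact hBne
    have hfamA : (fun j => Ut (VA j)) = update U c A := by
      funext j; by_cases hj : j = c
      · subst hj; rw [update_self, hVAc]; rfl
      · rw [update_of_ne hj, hVAj hj]; rfl
    have hfamB : (fun j => Ut (VB j)) = update U c B := by
      funext j; by_cases hj : j = c
      · subst hj; rw [update_self, hVBc]; rfl
      · rw [update_of_ne hj, hVBj hj]; rfl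
    have hZA' : SuppZeroFlag (k + 1 + 2) (fun j => Ut (VA j)) := by rw [hfamA]; exact hZA
    have hZB' : SuppZeroFlag (k + 1 + 2) (fun j => Ut (VB j)) := by rw [hfamB]; exact hZB
    have hXA : Structured Ut (univ.image VA) := structured_of_suppZeroFlag (k + 1) Ut hUtU hUtne VA hVAinj hZA'
    have hXB : Structured Ut (univ.image VB) := structured_of_suppZeroFlag (k + 1) Ut hUtU hUtne VB hVBinj hZB'
    -- the common part `W` = the members off `c`
    set W : Finset (Fin (k + 1 + 2) ⊕ Bool) := (univ.image Sum.inl).erase (Sum.inl c) with hW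
    have hmemW : ∀ {x}, x ∈ W ↔ ∃ j, j ≠ c ∧ Sum.inl j = x := by
      intro x
      rw [hW, mem_erase, mem_image]
      constructor
      · rintro ⟨hx, j, -, rfl⟩; exact ⟨j, fun h => hx (by rw [h]), rfl⟩
      · rintro ⟨j, hj, rfl⟩; exact ⟨fun h => hj (Sum.inl_injective h), j, mem_univ _, rfl⟩
    have hXAW : univ.image VA = insert (Sum.inr false) W := by
      ext x
      rw [mem_image, mem_insert, hmemW]
      constructor
      · rintro ⟨j, -, rfl⟩
        by_cases hj : j = c
        · left; rw [hj, hVAc]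
        · right; exact ⟨j, hj, (hVAj hj).symm⟩
      · rintro (rfl | ⟨j, hj, rfl⟩)
        · exact ⟨c, mem_univ _, hVAc⟩
        · exact ⟨j, mem_univ _, hVAj hj⟩
    have hXBW : univ.image VB = insert (Sum.inr true) W := by
      ext x
      rw [mem_image, mem_insert, hmemW]
      constructor
      · rintro ⟨j, -, rfl⟩
        by_cases hj : j = c
        · left; rw [hj, hVBc]
        · right; exact ⟨j, hj, (hVBj hj).symm⟩
      · rintro (rfl | ⟨j, hj, rfl⟩)
        · exact ⟨c, mem_univ _, hVBc⟩
        · exact ⟨j, mem_univ _, hVBj hj⟩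
    have hffW : Sum.inr false ∉ W := fun h => by obtain ⟨j, -, hj⟩ := hmemW.1 h; exact Sum.inl_ne_inr hj
    have httW : Sum.inr true ∉ W := fun h => by obtain ⟨j, -, hj⟩ := hmemW.1 h; exact Sum.inl_ne_inr hj
    have hcW : Sum.inl c ∉ W := fun h => by obtain ⟨j, hj, hj'⟩ := hmemW.1 h; exact hj (Sum.inl_injective hj')
    have hWA : (univ.image VA).erase (Sum.inr false) = W := by rw [hXAW, erase_insert hffW]
    have hWB : (univ.image VB).erase (Sum.inr true) = W := by rw [hXBW, erase_insert httW]
    have hinlW : insert (Sum.inl c) W = univ.image Sum.inl := by rw [hW, insert_erase (mem_image_of_mem _ (mem_univ c))]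
    have hffA : Sum.inr false ∈ univ.image VA := by rw [hXAW]; exact mem_insert_self _ _
    have httB : Sum.inr true ∈ univ.image VB := by rw [hXBW]; exact mem_insert_self _ _
    by_cases hWs : Structured Ut W
    · /- CASE 1: the members off `c` are structured: `A`, `B`, hence the glued event, are last-able over them -/
      obtain ⟨lW, hlW, -, -, hgW⟩ := Structured.exists_chain Ut hWs
      have hgA : GoodChain Ut (Sum.inr false :: lW) :=
        goodChain_cons_of_structured_erase Ut hUtU hUtne hXA hffA (by rw [hlW, hWA]) hgW
      have hgB : GoodChain Ut (Sum.inr true :: lW) :=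
        goodChain_cons_of_structured_erase Ut hUtU hUtne hXB httB (by rw [hlW, hWB]) hgW
      have hNA : hull (frameSupp Ut lW) A \ A ⊆ Safe Ut lW.toFinset := ((goodChain_cons Ut).1 hgA).2.2
      have hNB : hull (frameSupp Ut lW) B \ B ⊆ Safe Ut lW.toFinset := ((goodChain_cons Ut).1 hgB).2.2
      have heS : e ∉ frameSupp Ut lW := by
        refine notMem_frameSupp_of_forall Ut fun w hw => ?_
        obtain ⟨j, hj, rfl⟩ := hmemW.1 (hlW ▸ List.mem_toFinset.2 hw)
        exact heU j hj
      have hgC : GoodChain Ut (Sum.inl c :: lW) := by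
        rw [goodChain_cons]
        refine ⟨hgW, fun h => hcW (hlW ▸ List.mem_toFinset.2 h), ?_⟩
        show hull (frameSupp Ut lW) (U c) \ U c ⊆ Safe Ut lW.toFinset
        rw [hUc]
        exact (annihilator_glue_subset heS A B).trans (Set.union_subset hNA hNB)
      exact suppZeroFlag_of_goodChain Ut hUtU hUtne Sum.inl Sum.inl_injective
        (by rw [List.toFinset_cons, hlW, hinlW]) hgC
    · /- CASE 2: some member `i` off `c` has a non-empty annihilator, in `U[c ↦ A]` and (frame agreement) in `U[c ↦ B]` -/
      have hex : ∃ i : Fin (k + 1 + 2), i ≠ c ∧ ¬ (cframe Ut (univ.image VA) (Sum.inl i) ⊆ U i) := by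
        by_contra hall
        push Not at hall
        apply hWs
        -- all members off `c` are pure: pairwise disjoint supports, a structured frame
        have hd : ∀ j j' : Fin (k + 2), j ≠ j' → Disjoint (esupp (U (c.succAbove j))) (esupp (U (c.succAbove j'))) := by
          intro j j' hjj'
          have hj : c.succAbove j ≠ c := Fin.succAbove_ne c j
          have hj' : c.succAbove j' ≠ c := Fin.succAbove_ne c j'
          have e1 : cframe Ut (univ.image VA) (Sum.inl (c.succAbove j)) = U (c.succAbove j) :=
            Set.Subset.antisymm (hall _ hj) (subset_cframe Ut hUtU (univ.image VA) (Sum.inl (c.succAbove j)))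
          have e2 : cframe Ut (univ.image VA) (Sum.inl (c.succAbove j')) = U (c.succAbove j') :=
            Set.Subset.antisymm (hall _ hj') (subset_cframe Ut hUtU (univ.image VA) (Sum.inl (c.succAbove j')))
          have hm : Sum.inl (c.succAbove j) ∈ univ.image VA := mem_image.2 ⟨_, mem_univ _, hVAj hj⟩
          have hm' : Sum.inl (c.succAbove j') ∈ univ.image VA := mem_image.2 ⟨_, mem_univ _, hVAj hj'⟩
          have := disjoint_esupp_cframe Ut hUtU hUtne hXA hm hm'
            (fun h => hjj' (Fin.succAbove_right_injective (Sum.inl_injective h)))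
          rwa [e1, e2] at this
        have hZV : SuppZeroFlag (k + 2) (fun j => U (c.succAbove j)) :=
          suppZeroFlag_of_pairwise_disjoint k _ (fun j => esupp (U (c.succAbove j))) hd fun j => determinedBy_esupp (hU _)
        have hZV' : SuppZeroFlag (k + 2) (fun j => Ut (Sum.inl (c.succAbove j))) := hZV
        have hSV := structured_of_suppZeroFlag k Ut hUtU hUtne (fun j => Sum.inl (c.succAbove j))
          (Sum.inl_injective.comp Fin.succAbove_right_injective) hZV'
        rwa [image_succAbove_eq_erase Sum.inl Sum.inl_injective c, ← hW] at hSV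
      obtain ⟨i, hic, hNi⟩ := hex
      have hVAi : VA i = Sum.inl i := hVAj hic
      have hVBi : VB i = Sum.inl i := hVBj hic
      have hiA : Sum.inl i ∈ univ.image VA := mem_image.2 ⟨i, mem_univ _, hVAi⟩
      have hiB : Sum.inl i ∈ univ.image VB := mem_image.2 ⟨i, mem_univ _, hVBi⟩
      have hiW : Sum.inl i ∈ W := hmemW.2 ⟨i, hic, rfl⟩
      -- frame agreement between the two extensions of `W`
      have hWsubA : W ⊆ univ.image VA := by rw [hXAW]; exact subset_insert _ _
      have hWsubB : W ⊆ univ.image VB := by rw [hXBW]; exact subset_insert _ _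
      have hcoA : (univ.image VA \ W).card ≤ 1 := by
        rw [hXAW]; refine card_le_one.2 fun a ha b hb => ?_
        rw [mem_sdiff, mem_insert] at ha hb
        rw [ha.1.resolve_right ha.2, hb.1.resolve_right hb.2]
      have hcoB : (univ.image VB \ W).card ≤ 1 := by
        rw [hXBW]; refine card_le_one.2 fun a ha b hb => ?_
        rw [mem_sdiff, mem_insert] at ha hb
        rw [ha.1.resolve_right ha.2, hb.1.resolve_right hb.2]
      have hcf : cframe Ut (univ.image VB) (Sum.inl i) = cframe Ut (univ.image VA) (Sum.inl i) :=
        cframe_eq_of_supersets Ut hUtU hUtne hXB hXA hWsubB hWsubA hcoB hcoA hiW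
      have hNiB : ¬ (cframe Ut (univ.image VB) (Sum.inl i) ⊆ U i) := by rwa [hcf]
      -- `inl i` is removable in both; put it last (SYM)
      have hXAi : Structured Ut ((univ.image VA).erase (Sum.inl i)) := structured_erase_of_not_subset Ut hUtU hUtne hXA hiA hNi
      have hXBi : Structured Ut ((univ.image VB).erase (Sum.inl i)) := structured_erase_of_not_subset Ut hUtU hUtne hXB hiB hNiB
      obtain ⟨lA, hlA, -, -, hglA⟩ := Structured.exists_chain Ut hXAi
      obtain ⟨lB, hlB, -, -, hglB⟩ := Structured.exists_chain Ut hXBi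
      have hconsA : GoodChain Ut (Sum.inl i :: lA) := goodChain_cons_of_structured_erase Ut hUtU hUtne hXA hiA hlA hglA
      have hconsB : GoodChain Ut (Sum.inl i :: lB) := goodChain_cons_of_structured_erase Ut hUtU hUtne hXB hiB hlB hglB
      -- the reduced enumerations
      have hinjA : Injective (fun j => VA (i.succAbove j)) := hVAinj.comp Fin.succAbove_right_injective
      have hinjB : Injective (fun j => VB (i.succAbove j)) := hVBinj.comp Fin.succAbove_right_injective
      have himA : univ.image (fun j => VA (i.succAbove j)) = (univ.image VA).erase (Sum.inl i) := by
        rw [image_succAbove_eq_erase VA hVAinj i, hVAi]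
      have himB : univ.image (fun j => VB (i.succAbove j)) = (univ.image VB).erase (Sum.inl i) := by
        rw [image_succAbove_eq_erase VB hVBinj i, hVBi]
      -- the slot of `c` in the reduced family
      obtain ⟨c', hc'⟩ := Fin.exists_succAbove_eq (Ne.symm hic)
      have hjc : ∀ {j}, j ≠ c' → i.succAbove j ≠ c := fun hj h => hj (Fin.succAbove_right_injective (h.trans hc'.symm))
      have heU' : ∀ j, j ≠ c' → ¬ Affects (U (i.succAbove j)) e := fun j hj => heU _ (hjc hj)
      have hUc' : U (i.succAbove c') = A ∪ (B ∩ Pe) := by rw [hc']; exact hUc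
      have heAi : ¬ Affects (A ∩ U i) e := fun h => (affects_inter_imp h).elim heA (heU i hic)
      have heBi : ¬ Affects (B ∩ U i) e := fun h => (affects_inter_imp h).elim heB (heU i hic)
      -- members of the two reduced chains
      have hffl : Sum.inr false ∈ lA := List.mem_toFinset.1 (by rw [hlA]; exact mem_erase.2 ⟨Sum.inr_ne_inl, hffA⟩)
      have httl : Sum.inr true ∈ lB := List.mem_toFinset.1 (by rw [hlB]; exact mem_erase.2 ⟨Sum.inr_ne_inl, httB⟩)
      refine ⟨i, ?_, fun l => ?_⟩
      · /- the family off `i` -/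
        have hZ1A : SuppZeroFlag (k + 2) (update (fun j => U (i.succAbove j)) c' A) := by
          have h := suppZeroFlag_of_structured k Ut hUtU hUtne (fun j => VA (i.succAbove j)) hinjA (by rw [himA]; exact hXAi)
          have hfun : (fun j => Ut (VA (i.succAbove j))) = update (fun j => U (i.succAbove j)) c' A := by
            funext j; by_cases hj : j = c'
            · subst hj; rw [update_self, hc', hVAc]; rfl
            · rw [update_of_ne hj, hVAj (hjc hj)]; rfl
          rw [← hfun]; exact h
        have hZ1B : SuppZeroFlag (k + 2) (update (fun j => U (i.succAbove j)) c' B) := by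
          have h := suppZeroFlag_of_structured k Ut hUtU hUtne (fun j => VB (i.succAbove j)) hinjB (by rw [himB]; exact hXBi)
          have hfun : (fun j => Ut (VB (i.succAbove j))) = update (fun j => U (i.succAbove j)) c' B := by
            funext j; by_cases hj : j = c'
            · subst hj; rw [update_self, hc', hVBc]; rfl
            · rw [update_of_ne hj, hVBj (hjc hj)]; rfl
          rw [← hfun]; exact h
        exact suppZeroFlag_glue k (fun j => U (i.succAbove j)) c' A B e (fun j => hU _) hA hB hAB heU' heA heB hUc' hZ1A hZ1B
      · /- the shrunk families -/
        by_cases hl : l = c'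
        · /- the `c`-slot shrunk by `U i`: glue `A ∩ U i ⊆ B ∩ U i` -/
          subst hl
          -- D on the two chains, at the slot of `A` resp. `B`
          have hDA := (structured_update_inter_head Ut hUtU hUtne hconsA hffl).1
          have hDB := (structured_update_inter_head Ut hUtU hUtne hconsB httl).1
          set UA' := update Ut (Sum.inr false) (Ut (Sum.inr false) ∩ Ut (Sum.inl i)) with hUA'
          set UB' := update Ut (Sum.inr true) (Ut (Sum.inr true) ∩ Ut (Sum.inl i)) with hUB'
          have hUA'U : ∀ x, IsUpperSet (UA' x) := isUpperSet_update_inter_family Ut hUtU (Sum.inr false) (hUtU (Sum.inl i))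
          have hUA'ne : ∀ x, (UA' x).Nonempty :=
            nonempty_update_inter_family Ut hUtU hUtne (Sum.inr false) (hUtU (Sum.inl i)) (hUtne (Sum.inl i))
          have hUB'U : ∀ x, IsUpperSet (UB' x) := isUpperSet_update_inter_family Ut hUtU (Sum.inr true) (hUtU (Sum.inl i))
          have hUB'ne : ∀ x, (UB' x).Nonempty :=
            nonempty_update_inter_family Ut hUtU hUtne (Sum.inr true) (hUtU (Sum.inl i)) (hUtne (Sum.inl i))
          have hZA'' : SuppZeroFlag (k + 2) (update (fun j => U (i.succAbove j)) l (A ∩ U i)) := by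
            have h := suppZeroFlag_of_structured k UA' hUA'U hUA'ne (fun j => VA (i.succAbove j)) hinjA
              (by rw [himA, ← hlA]; exact hDA)
            have hfun : (fun j => UA' (VA (i.succAbove j))) = update (fun j => U (i.succAbove j)) l (A ∩ U i) := by
              funext j; by_cases hj : j = l
              · subst hj; rw [update_self, hc', hVAc, hUA', update_self]; rfl
              · rw [update_of_ne hj, hVAj (hjc hj), hUA', update_of_ne Sum.inl_ne_inr]; rfl
            rw [← hfun]; exact h
          have hZB'' : SuppZeroFlag (k + 2) (update (fun j => U (i.succAbove j)) l (B ∩ U i)) := by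
            have h := suppZeroFlag_of_structured k UB' hUB'U hUB'ne (fun j => VB (i.succAbove j)) hinjB
              (by rw [himB, ← hlB]; exact hDB)
            have hfun : (fun j => UB' (VB (i.succAbove j))) = update (fun j => U (i.succAbove j)) l (B ∩ U i) := by
              funext j; by_cases hj : j = l
              · subst hj; rw [update_self, hc', hVBc, hUB', update_self]; rfl
              · rw [update_of_ne hj, hVBj (hjc hj), hUB', update_of_ne Sum.inl_ne_inr]; rfl
            rw [← hfun]; exact h
          set F := update (fun j => U (i.succAbove j)) l (U (i.succAbove l) ∩ U i) with hF
          have hFU : ∀ j, IsUpperSet (F j) := by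
            intro j; rw [hF]
            by_cases hj : j = l
            · rw [hj, update_self]; exact (hU _).inter (hU i)
            · rw [update_of_ne hj]; exact hU _
          have heF : ∀ j, j ≠ l → ¬ Affects (F j) e := fun j hj => by rw [hF, update_of_ne hj]; exact heU' j hj
          have hFc : F l = (A ∩ U i) ∪ ((B ∩ U i) ∩ Pe) := by
            rw [hF, update_self, hUc']
            ext ω
            simp only [Set.mem_inter_iff, Set.mem_union]
            tauto
          have hFA : update F l (A ∩ U i) = update (fun j => U (i.succAbove j)) l (A ∩ U i) := by rw [hF, update_idem]
          have hFB : update F l (B ∩ U i) = update (fun j => U (i.succAbove j)) l (B ∩ U i) := by rw [hF, update_idem]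
          exact suppZeroFlag_glue k F l (A ∩ U i) (B ∩ U i) e hFU (hA.inter (hU i)) (hB.inter (hU i))
            (Set.inter_subset_inter_left _ hAB) heF heAi heBi hFc (by rw [hFA]; exact hZA'') (by rw [hFB]; exact hZB'')
        · /- a member `j₀` off `c` shrunk by `U i`: glue the same `A ⊆ B` -/
          set j₀ := i.succAbove l with hj₀
          have hj₀c : j₀ ≠ c := hjc hl
          have hj₀i : j₀ ≠ i := Fin.succAbove_ne i l
          have hj₀A : Sum.inl j₀ ∈ lA := List.mem_toFinset.1 (by
            rw [hlA]; exact mem_erase.2 ⟨fun h => hj₀i (Sum.inl_injective h), mem_image.2 ⟨j₀, mem_univ _, hVAj hj₀c⟩⟩)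
          have hj₀B : Sum.inl j₀ ∈ lB := List.mem_toFinset.1 (by
            rw [hlB]; exact mem_erase.2 ⟨fun h => hj₀i (Sum.inl_injective h), mem_image.2 ⟨j₀, mem_univ _, hVBj hj₀c⟩⟩)
          have hDA := (structured_update_inter_head Ut hUtU hUtne hconsA hj₀A).1
          have hDB := (structured_update_inter_head Ut hUtU hUtne hconsB hj₀B).1
          set U₀ := update Ut (Sum.inl j₀) (Ut (Sum.inl j₀) ∩ Ut (Sum.inl i)) with hU₀
          have hU₀U : ∀ x, IsUpperSet (U₀ x) := isUpperSet_update_inter_family Ut hUtU (Sum.inl j₀) (hUtU (Sum.inl i))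
          have hU₀ne : ∀ x, (U₀ x).Nonempty :=
            nonempty_update_inter_family Ut hUtU hUtne (Sum.inl j₀) (hUtU (Sum.inl i)) (hUtne (Sum.inl i))
          set F := update (fun j => U (i.succAbove j)) l (U (i.succAbove l) ∩ U i) with hF
          have hne₀ : ∀ {j}, j ≠ l → Sum.inl (i.succAbove j) ≠ (Sum.inl j₀ : Fin (k + 1 + 2) ⊕ Bool) :=
            fun hjl h => hjl (Fin.succAbove_right_injective (Sum.inl_injective h))
          have hZA'' : SuppZeroFlag (k + 2) (update F c' A) := by
            have h := suppZeroFlag_of_structured k U₀ hU₀U hU₀ne (fun j => VA (i.succAbove j)) hinjA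
              (by rw [himA, ← hlA]; exact hDA)
            have hfun : (fun j => U₀ (VA (i.succAbove j))) = update F c' A := by
              funext j; by_cases hj : j = c'
              · subst hj; rw [update_self, hc', hVAc, hU₀, update_of_ne Sum.inr_ne_inl]; rfl
              · rw [update_of_ne hj, hVAj (hjc hj), hF]
                by_cases hjl : j = l
                · subst hjl; rw [update_self, hU₀, update_self]; rfl
                · rw [update_of_ne hjl, hU₀, update_of_ne (hne₀ hjl)]; rfl
            rw [← hfun]; exact h
          have hZB'' : SuppZeroFlag (k + 2) (update F c' B) := by
            have h := suppZeroFlag_of_structured k U₀ hU₀U hU₀ne (fun j => VB (i.succAbove j)) hinjB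
              (by rw [himB, ← hlB]; exact hDB)
            have hfun : (fun j => U₀ (VB (i.succAbove j))) = update F c' B := by
              funext j; by_cases hj : j = c'
              · subst hj; rw [update_self, hc', hVBc, hU₀, update_of_ne Sum.inr_ne_inl]; rfl
              · rw [update_of_ne hj, hVBj (hjc hj), hF]
                by_cases hjl : j = l
                · subst hjl; rw [update_self, hU₀, update_self]; rfl
                · rw [update_of_ne hjl, hU₀, update_of_ne (hne₀ hjl)]; rfl
            rw [← hfun]; exact h
          have hFU : ∀ j, IsUpperSet (F j) := by
            intro j; rw [hF]
            by_cases hj : j = l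
            · rw [hj, update_self]; exact (hU _).inter (hU i)
            · rw [update_of_ne hj]; exact hU _
          have heF : ∀ j, j ≠ c' → ¬ Affects (F j) e := by
            intro j hj
            by_cases hjl : j = l
            · subst hjl; rw [hF, update_self]
              exact fun h => (affects_inter_imp h).elim (heU' j hj) (heU i hic)
            · rw [hF, update_of_ne hjl]; exact heU' j hj
          have hFc : F c' = A ∪ (B ∩ Pe) := by rw [hF, update_of_ne (Ne.symm hl), hUc']
          exact suppZeroFlag_glue k F c' A B e hFU hA hB hAB heF heA heB hFc hZA'' hZB''

/-- **Lemma P at every order (section form)**: if `e` acts on no member of `U` off the slot `c`, and both `e`-sections `U[c ↦ (U c)^{e←0}]`,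
`U[c ↦ (U c)^{e←1}]` lie in `Z_{k+2}`, then `U ∈ Z_{k+2}`.  (Minors of identically-zero families are identically zero, so in the minors
induction for (EQI-k) a terminal family has no private coordinate.) [this work] -/
theorem suppZeroFlag_of_secAt {k : ℕ} (U : Fin (k + 2) → Set (Set ι)) (hU : ∀ j, IsUpperSet (U j)) (c : Fin (k + 2)) (e : ι)
    (heU : ∀ j, j ≠ c → ¬ Affects (U j) e)
    (h0 : SuppZeroFlag (k + 2) (update U c (secAt e false (U c)))) (h1 : SuppZeroFlag (k + 2) (update U c (secAt e true (U c)))) :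
    SuppZeroFlag (k + 2) U :=
  suppZeroFlag_glue k U c (secAt e false (U c)) (secAt e true (U c)) e hU (isUpperSet_secAt e false (hU c))
    (isUpperSet_secAt e true (hU c)) (secAt_false_subset_true (hU c) e) heU (not_affects_secAt e false (U c))
    (not_affects_secAt e true (U c)) (eq_secAt_glue (hU c) e) h0 h1

/-- **Lemma P at every order (minor form)**: if `e` is private to the slot `c` (acts on no other member) and both `e`-minors of the
FAMILY — every member replaced by its `e`-section — lie in `Z_{k+2}`, then `U ∈ Z_{k+2}`. [this work] -/
theorem suppZeroFlag_of_minors_of_private {k : ℕ} (U : Fin (k + 2) → Set (Set ι)) (hU : ∀ j, IsUpperSet (U j)) (c : Fin (k + 2))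
    (e : ι) (heU : ∀ j, j ≠ c → ¬ Affects (U j) e)
    (h0 : SuppZeroFlag (k + 2) (fun j => secAt e false (U j))) (h1 : SuppZeroFlag (k + 2) (fun j => secAt e true (U j))) :
    SuppZeroFlag (k + 2) U := by
  have hsec : ∀ b : Bool, (fun j => secAt e b (U j)) = update U c (secAt e b (U c)) := by
    intro b; funext j
    by_cases hj : j = c
    · subst hj; rw [update_self]
    · rw [update_of_ne hj, secAt_eq_self_of_not_affects (hU j) (heU j hj)]
  rw [hsec] at h0 h1
  exact suppZeroFlag_of_secAt U hU c e heU h0 h1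

end Glue

end Summit.CriticalPhenomena.PercolationContinuityZ3.Theorems
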